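import Summits.CriticalPhenomena.PercolationContinuityZ3.Theorems.PercNearOneGluingNoHeavyLowerTailSuperTerminalQuarticGluing
import Summits.CriticalPhenomena.PercolationContinuityZ3.Theorems.PercNearOneGluingNoHeavyLowerTailSuperTerminalPortTree
import HarnessLib

/-!
# THEOREM T: the super-terminal quartic law `V4` on the port-tree class

Support file for crux `stmt-CriticalPhenomena-4575` (`NoHeavyLowerTail`), seat `prim-facecert` gen 22 (`--supports stmt-CriticalPhenomena-4575`);
memo `run/shared/lean/prim/prim-l12/prim-facecert/FINDING-gen22-PENDANT-PORT-TREE-CLASS.md` §0/§3.  No definitions, no sorries, standard axioms.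

`V4 : μ(F ∩ c∤T)⁴ ≤ μ(F ∩ c∤{s,a})²·μ(F ∩ (c↔b)ᶜ)²·μ(c∤T)` (`F = (s↔a)∩(s↔b)ᶜ`, `T = {s,a,b}`) holds on every finite weighted graph whose port component
admits a rooted-tree certificate `(K, par, rk)` (the positive non-terminal pairs at the component of the port `c` in `G − {s,a,b}` form a tree; everything
else arbitrary): the abstract port-tree induction `SuperTerminalPortTree.row_of_portTree` fed with the ∥-stability of `V4`
(`SuperTerminalQuarticGluing.superTerminalQuartic_of_pieces`, lead g134 THEOREM B / l12-p1 g32), the pendant transfer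
`SuperTerminalQuarticPendant.superTerminalQuartic_pendant` and `superTerminalQuartic_isolatedPort`.  Contains the vertex-cover class of THEOREM H4
(`…SuperTerminalQuarticHubGraphsVC`) and every port tree with arbitrary terminal attachments.  Hence `P3½`, `TCB′½` there (`…SuperTerminalQuarticFace`).
-/

namespace Summit.CriticalPhenomena.PercolationContinuityZ3.Theorems.SuperTerminalQuarticPortTree

open MeasureTheory Set
open Literature.Probability.Percolation Literature.Probability.Percolation.PartitionGluing
open Literature.Probability.LatticeModels (prodBernoulli)
open scoped Classical

variable {V : Type*} [Fintype V]

/-- **THEOREM T (`V4` on port trees).** [this work] -/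
theorem superTerminalQuartic_of_portTree {s a b : V} (hsa : s ≠ a) (hsb : s ≠ b) (hab : a ≠ b)
    (w : Sym2 V → unitInterval) (c : V) (K : Finset V) (par : V → V) (rk : V → ℕ)
    (hcK : c ∈ K) (hKT : ∀ v ∈ K, v ≠ s ∧ v ≠ a ∧ v ≠ b) (hrc : rk c = 0)
    (hpar : ∀ v ∈ K, v ≠ c → par v ∈ K ∧ rk v = rk (par v) + 1)
    (hclosed : ∀ x ∈ K, ∀ y : V, y ≠ s → y ≠ a → y ≠ b → y ≠ x → (0 : ℝ) < w s(x, y) →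
      y ∈ K ∧ ((par x = y ∧ rk x = rk y + 1) ∨ (par y = x ∧ rk y = rk x + 1))) :
    (prodBernoulli w).real (openConn s a ∩ (openConn s b)ᶜ ∩ ((openConn c s)ᶜ ∩ (openConn c a)ᶜ ∩ (openConn c b)ᶜ) : Set (BondConfig V)) ^ 4 ≤
      (prodBernoulli w).real (openConn s a ∩ (openConn s b)ᶜ ∩ ((openConn c s)ᶜ ∩ (openConn c a)ᶜ) : Set (BondConfig V)) ^ 2 *
      (prodBernoulli w).real (openConn s a ∩ (openConn s b)ᶜ ∩ (openConn c b)ᶜ : Set (BondConfig V)) ^ 2 *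
      (prodBernoulli w).real ((openConn c s)ᶜ ∩ (openConn c a)ᶜ ∩ (openConn c b)ᶜ : Set (BondConfig V)) := by
  refine SuperTerminalPortTree.row_of_portTree
    (fun (w : Sym2 V → unitInterval) (c : V) =>
      (prodBernoulli w).real (openConn s a ∩ (openConn s b)ᶜ ∩ ((openConn c s)ᶜ ∩ (openConn c a)ᶜ ∩ (openConn c b)ᶜ) : Set (BondConfig V)) ^ 4 ≤
      (prodBernoulli w).real (openConn s a ∩ (openConn s b)ᶜ ∩ ((openConn c s)ᶜ ∩ (openConn c a)ᶜ) : Set (BondConfig V)) ^ 2 *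
      (prodBernoulli w).real (openConn s a ∩ (openConn s b)ᶜ ∩ (openConn c b)ᶜ : Set (BondConfig V)) ^ 2 *
      (prodBernoulli w).real ((openConn c s)ᶜ ∩ (openConn c a)ᶜ ∩ (openConn c b)ᶜ : Set (BondConfig V)))
    ?_ ?_ ?_ hsa hsb hab w c K par rk hcK hKT hrc hpar hclosed
  · intro w c hsa hsb hsc hab hac hbc part hw hrow
    exact SuperTerminalQuarticGluing.superTerminalQuartic_of_pieces w ⟨hsa, hsb, hsc, hab, hac, hbc⟩ part hw hrow
  · intro w c x hsc hac hbc hxc hpend h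
    exact SuperTerminalQuarticPendant.superTerminalQuartic_pendant w hsc hac hbc hxc hpend h
  · intro w c hsc hac hbc hiso
    exact SuperTerminalQuarticPendant.superTerminalQuartic_isolatedPort w hsc hac hbc hiso

end Summit.CriticalPhenomena.PercolationContinuityZ3.Theorems.SuperTerminalQuarticPortTree
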